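import Summits.CriticalPhenomena.Ising3DConformalLimit.Theorems.MoebiusLimitExists.Negative.EtaExists

/-!
# `MoebiusLimit` (item stmt-CriticalPhenomena-1344): the scaling dimension `Δ` is UNIQUE

Structural knowledge about the crux `…Theses.EnergyNotSigmaSquared.MoebiusLimit`
(= `PerfectScreening.MoebiusLimitExists`), standing crux disprover (D-0016); THEOREM-ONLY.
Since any `O(3)`+scale-covariant non-degenerate pointwise limit of the critical correlators on `ℤ³`
forces `η` to exist with `η = 2Δ − 1` (`Negative/EtaExists.lean`) and `η` is unique
(`HasIsingExponentEta.unique`), the dimension `Δ` is the SAME for all such limits, whatever the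
renormalisation `ρ` and the family `S` (`delta_unique_of_covariantLimits`): the `∃ Δ` of the crux is
a number determined by the lattice two-point function, `Δ = (1 + η)/2`, not a free parameter
(`moebiusLimit_iff_existsUnique_delta`). Predicted `Δ_σ = 0.5181489(10)` (conformal bootstrap).
-/

noncomputable section

namespace Summit.CriticalPhenomena.Ising3DConformalLimit.MoebiusLimitExistsNegative

open Literature.Probability.LatticeModels Filter Set
open scoped Topology

/-- **`Δ` is unique**: two `O(3)`-invariant, scale-covariant, non-degenerate pointwise limits of the
critical correlators on `ℤ³` (possibly with different renormalisations and different families)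
have the same scaling dimension. [cite: FrancescoMathieuSenechal1997, §4.3.1 eq. (4.56)] -/
theorem delta_unique_of_covariantLimits {ρ₁ ρ₂ : ℝ → ℝ} {Δ₁ Δ₂ : ℝ} {S₁ S₂ : CorrFamily 3}
    (hρ₁ : ∀ δ ∈ Set.Ioc (0:ℝ) 1, 0 < ρ₁ δ) (hlim₁ : HasPointwiseScalingLimit (criticalCorr 3) ρ₁ S₁)
    (hnd₁ : IsNondegenerateTwoPoint S₁) (hrot₁ : IsRotationInvariant S₁) (hsc₁ : IsScaleCovariant Δ₁ S₁)
    (hρ₂ : ∀ δ ∈ Set.Ioc (0:ℝ) 1, 0 < ρ₂ δ) (hlim₂ : HasPointwiseScalingLimit (criticalCorr 3) ρ₂ S₂)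
    (hnd₂ : IsNondegenerateTwoPoint S₂) (hrot₂ : IsRotationInvariant S₂) (hsc₂ : IsScaleCovariant Δ₂ S₂) :
    Δ₁ = Δ₂ := by
  have h₁ := hasIsingExponentEta_of_covariantLimit hρ₁ hlim₁ hnd₁ hrot₁ hsc₁
  have h₂ := hasIsingExponentEta_of_covariantLimit hρ₂ hlim₂ hnd₂ hrot₂ hsc₂
  have := HasIsingExponentEta.unique h₁ h₂
  linarith

/-- **`Δ = (1 + η)/2`**: for any such limit the dimension is read off the anomalous dimension of the
lattice two-point function. [cite: FrancescoMathieuSenechal1997, §4.3.1 eq. (4.56)] -/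
theorem delta_eq_of_eta {ρ : ℝ → ℝ} {Δ η : ℝ} {S : CorrFamily 3}
    (hρ : ∀ δ ∈ Set.Ioc (0:ℝ) 1, 0 < ρ δ) (hlim : HasPointwiseScalingLimit (criticalCorr 3) ρ S)
    (hnd : IsNondegenerateTwoPoint S) (hrot : IsRotationInvariant S) (hsc : IsScaleCovariant Δ S)
    (hη : HasIsingExponentEta 3 η) : Δ = (1 + η) / 2 := by
  have := HasIsingExponentEta.unique (hasIsingExponentEta_of_covariantLimit hρ hlim hnd hrot hsc) hη
  linarith

/-- **The crux with `∃ Δ` replaced by `∃! Δ`** is equivalent to the crux: the scaling dimension of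
a Möbius-covariant non-degenerate limit of the critical 3D Ising correlators is unique.
[cite: FrancescoMathieuSenechal1997, §4.3.1 eq. (4.56)] -/
theorem moebiusLimit_iff_existsUnique_delta :
    Summit.CriticalPhenomena.Ising3DConformalLimit.Theses.EnergyNotSigmaSquared.MoebiusLimit ↔
      ∃! Δ : ℝ, ∃ (ρ : ℝ → ℝ) (S : CorrFamily 3), (∀ δ ∈ Set.Ioc (0:ℝ) 1, 0 < ρ δ) ∧ 0 < Δ ∧
        HasPointwiseScalingLimit (criticalCorr 3) ρ S ∧ IsNondegenerateTwoPoint S ∧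
          IsMoebiusCovariant Δ S := by
  constructor
  · rintro ⟨ρ, Δ, S, hρ, hΔ, hlim, hnd, hM⟩
    refine ⟨Δ, ⟨ρ, S, hρ, hΔ, hlim, hnd, hM⟩, ?_⟩
    rintro Δ' ⟨ρ', S', hρ', -, hlim', hnd', hM'⟩
    exact delta_unique_of_covariantLimits hρ' hlim' hnd' hM'.isEuclideanInvariant.2 hM'.isScaleCovariant
      hρ hlim hnd hM.isEuclideanInvariant.2 hM.isScaleCovariant
  · rintro ⟨Δ, ⟨ρ, S, hρ, hΔ, hlim, hnd, hM⟩, -⟩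
    exact ⟨ρ, Δ, S, hρ, hΔ, hlim, hnd, hM⟩

/-- The Euclidean statement already pins `Δ`: two witnesses of `CritIsing3DEuclideanLimit`-type data
share their dimension, and it equals that of any crux witness. [cite: FrancescoMathieuSenechal1997, §4.3.1 eq. (4.56)] -/
theorem delta_eq_of_moebiusLimit_of_euclideanLimit {ρ₁ ρ₂ : ℝ → ℝ} {Δ₁ Δ₂ : ℝ} {S₁ S₂ : CorrFamily 3}
    (hρ₁ : ∀ δ ∈ Set.Ioc (0:ℝ) 1, 0 < ρ₁ δ) (hlim₁ : HasPointwiseScalingLimit (criticalCorr 3) ρ₁ S₁)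
    (hnd₁ : IsNondegenerateTwoPoint S₁) (hM₁ : IsMoebiusCovariant Δ₁ S₁)
    (hρ₂ : ∀ δ ∈ Set.Ioc (0:ℝ) 1, 0 < ρ₂ δ) (hlim₂ : HasPointwiseScalingLimit (criticalCorr 3) ρ₂ S₂)
    (hnd₂ : IsNondegenerateTwoPoint S₂) (hE₂ : IsEuclideanInvariant S₂) (hsc₂ : IsScaleCovariant Δ₂ S₂) :
    Δ₁ = Δ₂ :=
  delta_unique_of_covariantLimits hρ₁ hlim₁ hnd₁ hM₁.isEuclideanInvariant.2 hM₁.isScaleCovariant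
    hρ₂ hlim₂ hnd₂ hE₂.2 hsc₂

end Summit.CriticalPhenomena.Ising3DConformalLimit.MoebiusLimitExistsNegative

end
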